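import Summits.QuantumFields.BalabanUV.T4Continuum.Support.SkeletonFillFullNorms

/-!
# T⁴ programme, node NE3 — kinematic refinement lemma, leaf R1c∕R1d (row NE3-S4d): **THE COVARIANT FLUX GRADIENT OF
# THE CLOSED-FORM FILLING FROM ROOT-CLOSENESS** — a generic two-case reduction (file F4a `SkeletonFillFullGradReduce`)

Cell `pub-balaban`, NE3 formalisation swarm `b2b-balaban-t4-ne3-formalise-*`, unit `b2b-balaban-t4-ne3-formalise-leaf-04`
(LEAF PROVER 04, gen 2), written for row **S4d** of `t4/formal/NE3/LEAVES.md` BY ARRANGEMENT with its holder leaf-07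
(journal OFFER «F3-GRAD SPLIT» ∕ «F3-GRAD PLAN v1», 2026-08-20T08:12Z ∕ 08:19Z).  SOCKET: the fourth field of the owner's
`SmoothRefineOfApprox.ApproxRefine` (skeleton v1.2 (42S)) ∕ hypothesis (hfillG) of leaf-09's
`ApproxRefineAssembly.approxRefine_of_fillBounds`: a pointwise bound `‖covGrad W (flux W) x κ π‖ ≤ G` at EVERY bond and
plane for `W := fullFill L T h` (leaf-07's closed-form filling of all cells, `SkeletonFillFull`).

THE REDUCTION.  The gradient needs NO case analysis on the plaquettes — only the bond dichotomy «inside the block ∕ across a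
far face».  GENERIC LEMMA (§1, configuration-free, `Matrix n n ℂ`): if two unitary plaquette variables are each within `ρ` of
UNITARY ANCHORS `g`, `g′`, `g` within `a` of `1`, and the connecting bond value factors as `M·t` with `‖M − 1‖ ≤ ξ` and
`‖t g′ t⁻¹ − g‖ ≤ δ′`, then (`a + ρ + δ′ ≤ 1/2`)
`‖Ad_{M t}(log P′) − log P‖ ≤ 4ξ(a + ρ + δ′) + 2(2ρ + δ′)` (`mlog_units_conj`, the `½`-ball Lipschitz constant `2` of
`FederbushMean.norm_mlog_sub_mlog_le`, `‖log X‖ ≤ 2‖X − 1‖`, `‖Ad_M Y − Y‖ ≤ 2‖M − 1‖‖Y‖`).  APPLICATION (§2): for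
`W = fullFill L T h` with unitary data, roots within `a₀` of `1`, covariant root gradient `≤ δ` (leaf-07's `hδ`:
`‖T(z,λ)·h(z+e_λ;κ,ι)·T(z,λ)⁻¹ − h(z;κ,ι)‖ ≤ δ`), and the ROOT-CLOSENESS of every plaquette to its own cell's root,
`‖W(∂p_{μν}(L•z + q)) − h(z;μ,ν)‖ ≤ ρ` for all `q ∈ [0,L)^d` (HYPOTHESIS `hroot` here; the four plaquette cases of
`SkeletonFillFull` §4 sharpened from «within `a₀ + …` of `1`» (F3a–c) to «within `ρ = O(a₀² + δ)` of the ROOT» — file F4b),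
the bond `(x, κ)`, `x = L•z + q`, is either INSIDE the block (`q_κ < L − 1`: `W(x,κ) = Hκ(z,q)`, `t = 1`, `g′ = g`,
`ξ = θ = d(L−1)a₀`, `δ′ = 0`) or ACROSS the far face (`q_κ = L − 1`: `W(x,κ) = Hκ·Lκ·T(z,κ)`, `t = T(z,κ)`,
`g′ = h(z+e_κ;μ,ν)`, `ξ = θ + θ_L`, `θ_L = d(L−1)La₀`, `δ′ = δ`).  END (§2):
**`covGrad_fullFill_le_of_rootClose : ∀ x κ π, ‖covGrad (fullFill L T h) (flux (fullFill L T h)) x κ π‖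
  ≤ 4(θ + θ_L)(a₀ + ρ + δ) + 2(2ρ + δ)`** — second order in `a₀` plus the covariant root gradient, once `ρ` is (F4b).

HONEST FRAMING.  Norm bookkeeping for a kinematic construction (one configuration, one refinement step); no minimiser, no
variational problem, no conditional of the cell (`BetaPertH`, (B), G-an2-4); nothing here bears on infinite volume, a mass
gap, or the Clay problem; **NE3 is NOT proved**; `SmoothRefine` ∕ `ApproxRefine` NOT proved (the root-closeness `hroot`,
the small-field radius (F3d), the mismatch (S4e) and the assembly (R1-asm) are elsewhere).  Finite T⁴ rung (B)+1.
ABSOLUTE RULE kept: no printed sentence is a hypothesis; no `def … : Prop` fact; no `sorry`; axioms ⊆ {propext,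
Classical.choice, Quot.sound}.  PLACEMENT (human rule 2026-08-19): under `Summits/QuantumFields/BalabanUV/`; imports
leaf-07's F3a `SkeletonFillFullNorms` only (for F2's closed form and the unitary-word toolkit); restates nothing.
HONEST DEPENDENCY: continuum YM on T⁴ ⇐ BetaPertH ∧ nine spine estimates (0/9 proved); BetaPertH ⇐ (D1) ∧ (D4) ∧ CAP+tail;
G-an2-4 gates asym, D1 and NE2/3/4.
-/

set_option autoImplicit false

open scoped BigOperators Matrix Matrix.Norms.L2Operator
open NormedSpace

namespace Summit.QuantumFields.BalabanUV.T4Continuum.SkeletonFillFullGradReduce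

open Literature.MathematicalPhysics.QuantumFieldTheory.Balaban1983to89
open B7Prop1Explicit B7Prop2Explicit B7Prop1Local MatrixLog UnitaryModel
open T4AveragingDeficitWall hiding Site Plane Plaq Bond
open T4AveragingDeficitNonAbelian (Ad_mul Ad_sub)
open AveragingDeficitTransport AveragingDeficitNearIdentity GaugeFieldPerturbation
open FederbushMean (norm_mlog_sub_mlog_le)
open SkeletonLattice SkeletonFill SkeletonFillFull SkeletonFillFullNorms

noncomputable section

variable {d : ℕ} {n : Type*} [Fintype n] [DecidableEq n]

/-! ## §1 The generic lemma: covariant difference of logarithms from closeness to transported anchors -/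

section Generic

variable [Nonempty n]

/-- **Conjugation passes through the logarithm**: `Ad_t (log P) = log (t P t⁻¹)` for unitary `t` and `‖P − 1‖ < 1`
(B7 p. 24 «their logarithms are unitarily equivalent»; tree `B7Prop1Explicit.mlog_units_conj`). [folklore] -/
theorem Ad_mlog_eq {t P : (Matrix n n ℂ)ˣ} (ht : t ∈ unitaryUnits (Matrix n n ℂ)) (hP : ‖(P : Matrix n n ℂ) - 1‖ < 1) :
    Ad t (mlog (P : Matrix n n ℂ)) = mlog ((t * P * t⁻¹ : (Matrix n n ℂ)ˣ) : Matrix n n ℂ) := by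
  rw [Units.val_mul, Units.val_mul, mlog_units_conj (mem_U1_of_unitary ht) hP]
  rfl

omit [Nonempty n] in
/-- A transported plaquette stays close to the transported anchor: `‖t P′ t⁻¹ − g‖ ≤ ‖P′ − g′‖ + ‖t g′ t⁻¹ − g‖`.
[folklore] -/
theorem norm_conj_sub_anchor_le {t P' g g' : (Matrix n n ℂ)ˣ} (ht : t ∈ unitaryUnits (Matrix n n ℂ)) :
    ‖((t * P' * t⁻¹ : (Matrix n n ℂ)ˣ) : Matrix n n ℂ) - (g : Matrix n n ℂ)‖
      ≤ ‖(P' : Matrix n n ℂ) - (g' : Matrix n n ℂ)‖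
        + ‖((t * g' * t⁻¹ : (Matrix n n ℂ)ˣ) : Matrix n n ℂ) - (g : Matrix n n ℂ)‖ := by
  calc ‖((t * P' * t⁻¹ : (Matrix n n ℂ)ˣ) : Matrix n n ℂ) - (g : Matrix n n ℂ)‖
      ≤ ‖((t * P' * t⁻¹ : (Matrix n n ℂ)ˣ) : Matrix n n ℂ) - ((t * g' * t⁻¹ : (Matrix n n ℂ)ˣ) : Matrix n n ℂ)‖
        + ‖((t * g' * t⁻¹ : (Matrix n n ℂ)ˣ) : Matrix n n ℂ) - (g : Matrix n n ℂ)‖ := norm_sub_le_norm_sub_add_norm_sub _ _ _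
    _ = _ := by rw [norm_val_frame_sub ht ((unitaryUnits (Matrix n n ℂ)).inv_mem ht)]

/-- **THE GENERIC COVARIANT-DIFFERENCE LEMMA.**  Plaquette variables `P, P′` within `ρ` of anchors `g, g′`, `g` within
`a` of `1`, connecting bond value `M·t` with `‖M − 1‖ ≤ ξ` and transported anchor `‖t g′ t⁻¹ − g‖ ≤ δ′`, `M, t` unitary,
`a + ρ + δ′ ≤ 1/2`: then `‖Ad_{M t}(log P′) − log P‖ ≤ 4ξ(a + ρ + δ′) + 2(2ρ + δ′)`. [folklore] -/
theorem norm_Ad_mlog_sub_mlog_le {P P' g g' M t : (Matrix n n ℂ)ˣ}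
    (hM : M ∈ unitaryUnits (Matrix n n ℂ)) (ht : t ∈ unitaryUnits (Matrix n n ℂ))
    {ρ a δ' ξ : ℝ} (hρ : ‖(P : Matrix n n ℂ) - (g : Matrix n n ℂ)‖ ≤ ρ)
    (hρ' : ‖(P' : Matrix n n ℂ) - (g' : Matrix n n ℂ)‖ ≤ ρ) (ha : ‖(g : Matrix n n ℂ) - 1‖ ≤ a)
    (htr : ‖((t * g' * t⁻¹ : (Matrix n n ℂ)ˣ) : Matrix n n ℂ) - (g : Matrix n n ℂ)‖ ≤ δ')
    (hξ : ‖(M : Matrix n n ℂ) - 1‖ ≤ ξ) (hsmall : a + ρ + δ' ≤ 1 / 2) :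
    ‖Ad (M * t) (mlog (P' : Matrix n n ℂ)) - mlog (P : Matrix n n ℂ)‖
      ≤ 4 * ξ * (a + ρ + δ') + 2 * (2 * ρ + δ') := by
  have hρ0 : 0 ≤ ρ := (norm_nonneg _).trans hρ
  have hδ0 : 0 ≤ δ' := (norm_nonneg _).trans htr
  have hξ0 : 0 ≤ ξ := (norm_nonneg _).trans hξ
  -- the transported plaquette `Q = t P′ t⁻¹`
  set Q : (Matrix n n ℂ)ˣ := t * P' * t⁻¹ with hQdef
  have hQg : ‖(Q : Matrix n n ℂ) - (g : Matrix n n ℂ)‖ ≤ ρ + δ' :=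
    (norm_conj_sub_anchor_le (P' := P') (g := g) (g' := g') ht).trans (add_le_add hρ' htr)
  have hQ1 : ‖(Q : Matrix n n ℂ) - 1‖ ≤ 1 / 2 := by
    have := norm_sub_le_norm_sub_add_norm_sub (Q : Matrix n n ℂ) (g : Matrix n n ℂ) 1
    linarith
  have hP1 : ‖(P : Matrix n n ℂ) - 1‖ ≤ 1 / 2 := by
    have := norm_sub_le_norm_sub_add_norm_sub (P : Matrix n n ℂ) (g : Matrix n n ℂ) 1
    linarith
  have hP'1 : ‖(P' : Matrix n n ℂ) - 1‖ < 1 := by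
    have h1 : ‖((t * P' * t⁻¹ : (Matrix n n ℂ)ˣ) : Matrix n n ℂ) - ((t * 1 * t⁻¹ : (Matrix n n ℂ)ˣ) : Matrix n n ℂ)‖
        = ‖(P' : Matrix n n ℂ) - ((1 : (Matrix n n ℂ)ˣ) : Matrix n n ℂ)‖ :=
      norm_val_frame_sub ht ((unitaryUnits (Matrix n n ℂ)).inv_mem ht) P' 1
    rw [mul_one, mul_inv_cancel, Units.val_one, ← hQdef] at h1
    rw [← h1]; linarith
  -- `Ad_t (log P′) = log Q`
  have hY : Ad t (mlog (P' : Matrix n n ℂ)) = mlog (Q : Matrix n n ℂ) := Ad_mlog_eq ht hP'1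
  -- Lipschitz: `‖log Q − log P‖ ≤ 2 ‖Q − P‖ ≤ 2 (2ρ + δ′)`
  have hQP : ‖(Q : Matrix n n ℂ) - (P : Matrix n n ℂ)‖ ≤ 2 * ρ + δ' := by
    have := norm_sub_le_norm_sub_add_norm_sub (Q : Matrix n n ℂ) (g : Matrix n n ℂ) (P : Matrix n n ℂ)
    rw [norm_sub_rev (g : Matrix n n ℂ)] at this
    linarith
  have hlog : ‖mlog (Q : Matrix n n ℂ) - mlog (P : Matrix n n ℂ)‖ ≤ 2 * (2 * ρ + δ') := by
    have h := norm_mlog_sub_mlog_le (by norm_num : (1 / 2 : ℝ) < 1) hQ1 hP1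
    have hc : (1 + (1 / 2 : ℝ) / (1 - 1 / 2)) = 2 := by norm_num
    rw [hc] at h
    exact h.trans (by nlinarith [hQP])
  -- size of `log Q`: `≤ 2 ‖Q − 1‖ ≤ 2 (a + ρ + δ′)`
  have hYn : ‖mlog (Q : Matrix n n ℂ)‖ ≤ 2 * (a + ρ + δ') := by
    refine (norm_mlog_le_two_mul hQ1).trans ?_
    have := norm_sub_le_norm_sub_add_norm_sub (Q : Matrix n n ℂ) (g : Matrix n n ℂ) 1
    nlinarith
  -- `Ad_M` moves `log Q` by at most `2ξ ‖log Q‖`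
  have hAdM : ‖Ad M (mlog (Q : Matrix n n ℂ)) - mlog (Q : Matrix n n ℂ)‖ ≤ 4 * ξ * (a + ρ + δ') := by
    refine (norm_Ad_sub_le hM _).trans ?_
    have := mul_le_mul hξ hYn (norm_nonneg _) hξ0
    nlinarith
  -- assemble
  rw [Ad_mul, hY]
  calc ‖Ad M (mlog (Q : Matrix n n ℂ)) - mlog (P : Matrix n n ℂ)‖
      ≤ ‖Ad M (mlog (Q : Matrix n n ℂ)) - mlog (Q : Matrix n n ℂ)‖ + ‖mlog (Q : Matrix n n ℂ) - mlog (P : Matrix n n ℂ)‖ :=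
        norm_sub_le_norm_sub_add_norm_sub _ _ _
    _ ≤ 4 * ξ * (a + ρ + δ') + 2 * (2 * ρ + δ') := add_le_add hAdM hlog

end Generic

/-! ## §2 Application to the closed-form filling: the bond dichotomy -/

section Filling

variable [Nonempty n] {L : ℕ} {a₀ δ ρ : ℝ}

omit [Fintype n] [DecidableEq n] [Nonempty n] in
/-- Every fine site has block coordinates: `x = L•z + q` with `q ∈ [0,L)^d` (`L ≥ 1`). [folklore] -/
theorem exists_repr (hL : 1 ≤ L) (x : Site d) : ∃ z q : Site d, InBox L q ∧ x = (L : ℤ) • z + q :=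
  ⟨cdiv L x, cmod L x, fun i => ⟨cmod_nonneg hL x i, cmod_lt hL x i⟩, (smul_cdiv_add_cmod L x).symm⟩

/-- **THE COVARIANT FLUX GRADIENT OF THE FILLING FROM ROOT-CLOSENESS.**  Data: unitary `T`, `h`; roots within `a₀` of `1`;
covariant root gradient `≤ δ` across every coarse bond (leaf-07's `hδ`, all root planes); ROOT-CLOSENESS `hroot`: every
plaquette of `W := fullFill L T h` with corner `L•z + q`, `q ∈ [0,L)^d`, is within `ρ` of its cell's root `h(z;μ,ν)`;
smallness `a₀ + ρ + δ ≤ 1/2`.  Then at EVERY bond and plane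
`‖covGrad W (flux W) x κ π‖ ≤ 4(θ + θ_L)(a₀ + ρ + δ) + 2(2ρ + δ)`, `θ = d(L−1)a₀`, `θ_L = d(L−1)La₀`. [folklore] -/
theorem covGrad_fullFill_le_of_rootClose (hL : 1 ≤ L) {T : Site d → Fin d → (Matrix n n ℂ)ˣ}
    {h : Site d → Fin d → Fin d → (Matrix n n ℂ)ˣ}
    (hT : ∀ (z : Site d) (κ : Fin d), T z κ ∈ unitaryUnits (Matrix n n ℂ))
    (hh : ∀ (z : Site d) (κ ν : Fin d), h z κ ν ∈ unitaryUnits (Matrix n n ℂ))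
    (ha : ∀ (z : Site d) (κ ν : Fin d), κ < ν → ‖((h z κ ν : (Matrix n n ℂ)ˣ) : Matrix n n ℂ) - 1‖ ≤ a₀) (ha0 : 0 ≤ a₀)
    (hδ : ∀ (z : Site d) (lam κ ι : Fin d), κ < ι →
      ‖((T z lam * h (z + e lam) κ ι * (T z lam)⁻¹ : (Matrix n n ℂ)ˣ) : Matrix n n ℂ) - ((h z κ ι : (Matrix n n ℂ)ˣ) : Matrix n n ℂ)‖
        ≤ δ) (hδ0 : 0 ≤ δ)
    (hroot : ∀ (z q : Site d) (μ ν : Fin d), μ < ν → InBox L q →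
      ‖((hol (fullFill L T h) ((L : ℤ) • z + q) (plaqWord μ ν) : (Matrix n n ℂ)ˣ) : Matrix n n ℂ)
        - ((h z μ ν : (Matrix n n ℂ)ˣ) : Matrix n n ℂ)‖ ≤ ρ)
    (hsmall : a₀ + ρ + δ ≤ 1 / 2) (x : Site d) (κ : Fin d) (π : T4AveragingDeficitWall.Plane d) :
    ‖covGrad (fullFill L T h) (flux (fullFill L T h)) x κ π‖
      ≤ 4 * (d * ((L - 1 : ℕ) * a₀) + d * (((L - 1 : ℕ) * L) * a₀)) * (a₀ + ρ + δ) + 2 * (2 * ρ + δ) := by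
  obtain ⟨⟨μ, ν⟩, hμν⟩ := π
  obtain ⟨z, q, hq, rfl⟩ := exists_repr hL x
  have hρ0 : 0 ≤ ρ := (norm_nonneg _).trans (hroot z q μ ν hμν hq)
  -- unitarity of everything in sight
  have huA : ∀ (z' q' : Site d) (lam : Fin d), hiProd h z' q' lam ∈ unitaryUnits (Matrix n n ℂ) := fun _ _ _ =>
    prodOver_mem fun i _ => (unitaryUnits (Matrix n n ℂ)).inv_mem ((unitaryUnits (Matrix n n ℂ)).pow_mem (hh _ _ _) _)
  have huL : ∀ (z' q' : Site d) (lam : Fin d), loProd L h z' q' lam ∈ unitaryUnits (Matrix n n ℂ) := fun _ _ _ =>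
    prodOver_mem fun i _ => (unitaryUnits (Matrix n n ℂ)).pow_mem (hh _ _ _) _
  -- sizes of the row ∕ compensating products
  set θ : ℝ := d * ((L - 1 : ℕ) * a₀) with hθdef
  set θL : ℝ := d * (((L - 1 : ℕ) * L) * a₀) with hθLdef
  have hθ0 : 0 ≤ θ := by positivity
  have hθL0 : 0 ≤ θL := by positivity
  -- the plaquette at `x` and its anchor
  have hPg := hroot z q μ ν hμν hq
  -- unfold the covariant gradient
  show ‖Ad (fullFill L T h ((L : ℤ) • z + q) κ)
        (mlog ((hol (fullFill L T h) ((L : ℤ) • z + q + e κ) (plaqWord μ ν) : (Matrix n n ℂ)ˣ) : Matrix n n ℂ))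
      - mlog ((hol (fullFill L T h) ((L : ℤ) • z + q) (plaqWord μ ν) : (Matrix n n ℂ)ˣ) : Matrix n n ℂ)‖ ≤ _
  rw [fullFill_repr hq]
  by_cases hκ : q κ = (L : ℤ) - 1
  · -- ACROSS THE FAR FACE: `W(x,κ) = (Hκ Lκ)·T(z,κ)`, neighbour block `z + e_κ`
    have hq' := inBox_carry hL hq hκ
    have hP'g := hroot (z + e κ) (q + e κ - (L : ℤ) • e κ) μ ν hμν hq'
    rw [carry_repr, fullVal_of_eq hκ, show hiProd h z q κ * (loProd L h z q κ * T z κ)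
        = (hiProd h z q κ * loProd L h z q κ) * T z κ by group]
    have hM : ‖((hiProd h z q κ * loProd L h z q κ : (Matrix n n ℂ)ˣ) : Matrix n n ℂ) - 1‖ ≤ θ + θL := by
      rw [Units.val_mul]
      exact (B8Ineq170.norm_mul_sub_one_le_of_norm_le_one (norm_val_of_unitary (huA _ _ _)).le).trans
        (add_le_add (norm_hiProd_sub_one_le hh ha ha0 z hq κ) (norm_loProd_sub_one_le hh ha ha0 z hq κ))
    exact (norm_Ad_mlog_sub_mlog_le ((unitaryUnits (Matrix n n ℂ)).mul_mem (huA _ _ _) (huL _ _ _)) (hT z κ)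
      hPg hP'g (ha z μ ν hμν) (hδ z κ μ ν hμν) hM hsmall).trans le_rfl
  · -- INSIDE THE BLOCK: `W(x,κ) = Hκ(z,q)·1`, same block, same anchor
    have hκ' : q κ < (L : ℤ) - 1 := lt_of_le_of_ne (by have := (hq κ).2; omega) hκ
    have hq' := inBox_add_e hq hκ'
    have hP'g := hroot z (q + e κ) μ ν hμν hq'
    rw [add_assoc, fullVal_of_ne hκ, show hiProd h z q κ = hiProd h z q κ * 1 by rw [mul_one]]
    have hM : ‖((hiProd h z q κ : (Matrix n n ℂ)ˣ) : Matrix n n ℂ) - 1‖ ≤ θ := norm_hiProd_sub_one_le hh ha ha0 z hq κ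
    have htr : ‖((1 * h z μ ν * 1⁻¹ : (Matrix n n ℂ)ˣ) : Matrix n n ℂ) - ((h z μ ν : (Matrix n n ℂ)ˣ) : Matrix n n ℂ)‖ ≤ 0 := by
      simp
    have hsmall' : a₀ + ρ + 0 ≤ 1 / 2 := by linarith
    refine (norm_Ad_mlog_sub_mlog_le (huA _ _ _) (unitaryUnits (Matrix n n ℂ)).one_mem hPg hP'g (ha z μ ν hμν)
      htr hM hsmall').trans ?_
    nlinarith [mul_nonneg hθL0 (by positivity : (0 : ℝ) ≤ a₀ + ρ + δ), mul_nonneg hθ0 hδ0]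

end Filling

end

end Summit.QuantumFields.BalabanUV.T4Continuum.SkeletonFillFullGradReduce
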